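import Mathlib
import Literature.Analysis.Convex.ConeLiftCalculus
import HarnessLib

/-!
# Semidefinite lifts of spectral convex sets (Saunderson–Parrilo, Prop. 1 / Lemmas 6–8)

Topic `Literature/Analysis/Convex`. Let `K ⊆ ℝ^m` be convex and invariant under permutations of
the coordinates, and let `spec K = {U diag(z) Uᵀ : U orthogonal, z ∈ K}` be the associated
*spectral set* of symmetric matrices (the symmetric `Y` with `λ(Y) ∈ K`). Saunderson–Parrilo
(Math. Program. 153 (2015), arXiv:1208.1443, Prop. 1 with Lemmas 6–8, "Exploiting symmetry")
show that a semidefinite representation of `K` of size `r` yields one of `spec K` of size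
`r + O(m²)`, through the Schur–Horn cone: `Y ∈ spec K` iff there is `z ∈ K` with `λ(Y) ≺ z`
(majorisation), and `λ(Y) ≺ z` is expressed by `tr Y = ∑ zᵢ` and the Ky Fan epigraph LMIs
`∃ s, Z ⪰ 0, Y ⪯ Z + sI, tr Z + ℓ s ≤ z₁ + ⋯ + z_ℓ` (Lemma 8, Nesterov–Nemirovski).

This file proves that statement in the `K`-lift bookkeeping of `Literature.Analysis.Convex.ConeLift`
(`HasExpPsdLift C 0 r` = lifted LMI representation of psd-size `r`, no exponential cones):

* `hasExpPsdLift_spectralSet` — if `HasExpPsdLift K 0 r` and `K` is permutation invariant then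
  `HasExpPsdLift {Y | ∃ U, U Uᵀ = 1 ∧ ∃ z ∈ K, Y = U diag(z) Uᵀ} 0 (r + 2 + m (2m+1))`.

Ingredients, all proved here: the Hardy–Littlewood–Pólya transfer lemma in the form "a convex
permutation-invariant set containing `z` contains every `d ≺ z`" (`mem_of_majorized`, by the
classical `T`-transform induction, Marshall–Olkin–Arnold Lemma 2.B.1), the easy half of Ky Fan's
maximum principle (`sum_prefix_le_of_lmi`: the LMIs force `∑_{i<ℓ} λᵢ(Y) ≤ tr Z + ℓ s`), and
sorting bookkeeping. DEVIATIONS from the printed Lemma 7: the ordering constraints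
`z₁ ≥ ⋯ ≥ z_m` are dropped (unordered prefix sums are dominated by ordered ones, and `K` is
permutation invariant), and convexity of `K` is taken from its own lift.

## References

* [SaundersonParrilo2014] J. Saunderson, P. A. Parrilo, Math. Program. 153 (2015) 309–331
  (arXiv:1208.1443): Prop. 1, §4 Lemmas 6, 7, 8.
* A. W. Marshall, I. Olkin, B. C. Arnold, *Inequalities: Theory of Majorization and its
  Applications*, 2nd ed. (Springer 2011), Ch. 2 Lemma B.1 (T-transforms). [folklore]
-/

noncomputable section

open Matrix Finset
open scoped BigOperators

namespace Literature.Analysis.Convex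

/-! ### Prefix sums over `Fin N` -/

section Prefix

variable {N : ℕ}

/-- `|{i : Fin N | i < ℓ}| = ℓ` for `ℓ ≤ N`. [folklore] -/
theorem card_filter_val_lt {ℓ : ℕ} (hℓ : ℓ ≤ N) :
    (univ.filter (fun i : Fin N => (i : ℕ) < ℓ)).card = ℓ := by
  rw [← Finset.card_map Fin.valEmbedding]
  have : (univ.filter (fun i : Fin N => (i : ℕ) < ℓ)).map Fin.valEmbedding = Finset.range ℓ := by
    ext j
    simp only [Finset.mem_map, Finset.mem_filter, Finset.mem_univ, true_and, Fin.valEmbedding_apply,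
      Finset.mem_range]
    constructor
    · rintro ⟨i, hi, rfl⟩
      exact hi
    · intro hj
      exact ⟨⟨j, lt_of_lt_of_le hj hℓ⟩, hj, rfl⟩
  rw [this, Finset.card_range]

/-- For `ℓ ≥ N` the prefix is everything. [folklore] -/
theorem filter_val_lt_of_le {ℓ : ℕ} (hℓ : N ≤ ℓ) :
    univ.filter (fun i : Fin N => (i : ℕ) < ℓ) = univ := by
  ext i
  simp only [Finset.mem_filter, Finset.mem_univ, true_and, iff_true]
  exact lt_of_lt_of_le i.2 hℓ

/-- Splitting off the last index of a prefix: `∑_{i<ℓ+1} = ∑_{i<ℓ} + f ℓ` (`ℓ < N`). [folklore] -/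
theorem sum_filter_val_lt_succ (f : Fin N → ℝ) {ℓ : ℕ} (hℓ : ℓ < N) :
    ∑ i ∈ univ.filter (fun i : Fin N => (i : ℕ) < ℓ + 1), f i =
      ∑ i ∈ univ.filter (fun i : Fin N => (i : ℕ) < ℓ), f i + f ⟨ℓ, hℓ⟩ := by
  have : univ.filter (fun i : Fin N => (i : ℕ) < ℓ + 1) =
      insert ⟨ℓ, hℓ⟩ (univ.filter (fun i : Fin N => (i : ℕ) < ℓ)) := by
    ext i
    simp only [Finset.mem_filter, Finset.mem_univ, true_and, Finset.mem_insert, Fin.ext_iff]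
    omega
  rw [this, Finset.sum_insert (by simp), add_comm]

/-- A strictly monotone map `Fin m → Fin N` dominates the index: `j ≤ f j`. [folklore] -/
theorem val_le_of_strictMono {m : ℕ} {f : Fin m → Fin N} (hf : StrictMono f) (j : Fin m) :
    (j : ℕ) ≤ f j := by
  obtain ⟨j, hj⟩ := j
  induction j with
  | zero => exact Nat.zero_le _
  | succ j ih =>
    have h := hf (show (⟨j, by omega⟩ : Fin m) < ⟨j + 1, hj⟩ from Nat.lt_succ_self j)
    have := ih (by omega)
    exact Nat.succ_le_of_lt (lt_of_le_of_lt this h)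

/-- For an antitone `y : Fin N → ℝ`, the sum of `y` over any set `T` of indices is at most the sum
over the first `|T|` indices. [folklore] -/
theorem sum_le_sum_prefix_of_antitone {y : Fin N → ℝ} (hy : Antitone y) (T : Finset (Fin N)) :
    ∑ i ∈ T, y i ≤ ∑ i ∈ univ.filter (fun i : Fin N => (i : ℕ) < T.card), y i := by
  classical
  have hcard : T.card ≤ N := by simpa using T.card_le_univ
  set e := T.orderEmbOfFin rfl with he
  have h1 : ∑ i ∈ T, y i = ∑ j : Fin T.card, y (e j) := by
    conv_lhs => rw [← Finset.map_orderEmbOfFin_univ T rfl]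
    rw [Finset.sum_map]
    rfl
  set ι' : Fin T.card → Fin N := fun j => ⟨j, lt_of_lt_of_le j.2 hcard⟩ with hι'
  have hinj : Function.Injective ι' := fun a b h => Fin.ext (by simpa [hι'] using congrArg Fin.val h)
  have h2 : univ.filter (fun i : Fin N => (i : ℕ) < T.card) = Finset.univ.image ι' := by
    ext i
    simp only [Finset.mem_filter, Finset.mem_univ, true_and, Finset.mem_image, hι']
    constructor
    · intro hi
      exact ⟨⟨i, hi⟩, Fin.ext rfl⟩
    · rintro ⟨j, rfl⟩
      exact j.2
  rw [h1, h2, Finset.sum_image fun a _ b _ h => hinj h]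
  refine Finset.sum_le_sum fun j _ => hy ?_
  change (⟨j, _⟩ : Fin N) ≤ e j
  rw [Fin.le_def]
  exact val_le_of_strictMono e.strictMono j

/-- Prefix sums of a vector are dominated by the prefix sums of its antitone rearrangement.
[folklore] -/
theorem sum_prefix_le_sum_prefix_comp_of_antitone (y : Fin N → ℝ) (σ : Equiv.Perm (Fin N))
    (h : Antitone (y ∘ σ)) (ℓ : ℕ) :
    ∑ i ∈ univ.filter (fun i : Fin N => (i : ℕ) < ℓ), y i ≤
      ∑ i ∈ univ.filter (fun i : Fin N => (i : ℕ) < ℓ), y (σ i) := by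
  classical
  rcases le_or_gt N ℓ with hN | hN
  · rw [filter_val_lt_of_le hN]
    exact (Equiv.sum_comp σ y).symm.le
  set F := univ.filter (fun i : Fin N => (i : ℕ) < ℓ) with hF
  have h1 : ∑ i ∈ F, y i = ∑ j ∈ F.image σ.symm, (y ∘ σ) j := by
    rw [Finset.sum_image fun a _ b _ h => σ.symm.injective h]
    simp
  have hc : (F.image σ.symm).card = ℓ := by
    rw [Finset.card_image_of_injective _ σ.symm.injective, hF, card_filter_val_lt hN.le]
  rw [h1]
  have h2 := sum_le_sum_prefix_of_antitone h (F.image σ.symm)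
  rw [hc] at h2
  exact h2

/-- Existence of an antitone rearrangement of a real vector. [folklore] -/
theorem exists_perm_antitone (y : Fin N → ℝ) : ∃ σ : Equiv.Perm (Fin N), Antitone (y ∘ σ) := by
  refine ⟨Tuple.sort (fun i => -y i), fun i j hij => ?_⟩
  have h := Tuple.monotone_sort (fun i => -y i) hij
  simp only [Function.comp_apply] at h ⊢
  linarith

end Prefix

/-! ### The Hardy–Littlewood–Pólya transfer lemma -/

section HLP

variable {N : ℕ}

/-- **Transfer lemma (Hardy–Littlewood–Pólya / Muirhead; Marshall–Olkin–Arnold Lemma 2.B.1).**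
Let `K ⊆ ℝ^N` be convex and invariant under transpositions of coordinates, `z ∈ K` and `d`
antitone with `z` antitone, `∑ d = ∑ z` and `∑_{i<ℓ} d ≤ ∑_{i<ℓ} z` for all `ℓ` (`d ≺ z`). Then
`d ∈ K`: `d` is reached from `z` by finitely many `T`-transforms `λ·id + (1-λ)·(j k)`, each of
which stays in `K`. [folklore] -/
theorem mem_of_majorized_of_antitone {K : Set (Fin N → ℝ)} (hK : Convex ℝ K)
    (hswap : ∀ z ∈ K, ∀ j k : Fin N, z ∘ Equiv.swap j k ∈ K) {d : Fin N → ℝ} (hd : Antitone d) :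
    ∀ z : Fin N → ℝ, Antitone z → z ∈ K → ∑ i, z i = ∑ i, d i →
      (∀ ℓ : ℕ, ∑ i ∈ univ.filter (fun i : Fin N => (i : ℕ) < ℓ), d i ≤
        ∑ i ∈ univ.filter (fun i : Fin N => (i : ℕ) < ℓ), z i) → d ∈ K := by
  classical
  -- induction on the number of indices where `z` and `d` differ
  suffices H : ∀ (m : ℕ) (z : Fin N → ℝ), (univ.filter fun i => z i ≠ d i).card ≤ m →
      Antitone z → z ∈ K → ∑ i, z i = ∑ i, d i →
      (∀ ℓ : ℕ, ∑ i ∈ univ.filter (fun i : Fin N => (i : ℕ) < ℓ), d i ≤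
        ∑ i ∈ univ.filter (fun i : Fin N => (i : ℕ) < ℓ), z i) → d ∈ K from
    fun z hz hzK hsum hpre => H _ z le_rfl hz hzK hsum hpre
  intro m
  induction m with
  | zero =>
    intro z hm _ hzK _ _
    have hzd : z = d := by
      funext i
      by_contra h
      have : i ∈ univ.filter (fun i => z i ≠ d i) := by simp [h]
      rw [Nat.le_zero, Finset.card_eq_zero] at hm
      simp [hm] at this
    rwa [hzd] at hzK
  | succ m ih =>
    intro z hm hz hzK hsum hpre
    by_cases hzd : z = d
    · rwa [hzd] at hzK
    -- prefix notation
    set P : ℕ → Finset (Fin N) := fun ℓ => univ.filter (fun i : Fin N => (i : ℕ) < ℓ) with hP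
    have hPsucc : ∀ (f : Fin N → ℝ) (i : Fin N), ∑ t ∈ P ((i : ℕ) + 1), f t = ∑ t ∈ P i, f t + f i := by
      intro f i
      have := sum_filter_val_lt_succ f i.2
      simpa [hP] using this
    have hpreP : ∀ ℓ : ℕ, ∑ i ∈ P ℓ, d i ≤ ∑ i ∈ P ℓ, z i := hpre
    -- (E1) some index has `d j < z j`
    have hE1 : (univ.filter fun i : Fin N => d i < z i).Nonempty := by
      by_contra h
      rw [Finset.not_nonempty_iff_eq_empty, Finset.filter_eq_empty_iff] at h
      have hle : ∀ i ∈ (univ : Finset (Fin N)), z i ≤ d i := fun i hi => not_lt.1 (h hi)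
      have heq := (Finset.sum_eq_sum_iff_of_le hle).1 hsum
      exact hzd (funext fun i => heq i (Finset.mem_univ i))
    set j := (univ.filter fun i : Fin N => d i < z i).max' hE1 with hj
    have hj_mem : d j < z j := (Finset.mem_filter.1 (Finset.max'_mem _ hE1)).2
    have hj_max : ∀ i : Fin N, j < i → z i ≤ d i := by
      intro i hi
      by_contra h
      have := Finset.le_max' (univ.filter fun i : Fin N => d i < z i) i
        (Finset.mem_filter.2 ⟨Finset.mem_univ i, not_le.1 h⟩)
      rw [← hj] at this
      exact absurd hi (not_lt.2 this)
    -- (E2) some index `k > j` has `z k < d k`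
    have hE2 : (univ.filter fun i : Fin N => j < i ∧ z i < d i).Nonempty := by
      by_contra h
      rw [Finset.not_nonempty_iff_eq_empty, Finset.filter_eq_empty_iff] at h
      have hge : ∀ i : Fin N, j < i → z i = d i := by
        intro i hi
        have h1 := hj_max i hi
        have h2 : ¬ (z i < d i) := fun h' => h (Finset.mem_univ i) ⟨hi, h'⟩
        exact le_antisymm h1 (not_lt.1 h2)
      -- then `∑ z - ∑ d = ∑_{i ≤ j} (z i - d i) ≥ z j - d j > 0`
      have hsplit : ∀ f : Fin N → ℝ, ∑ i, f i = ∑ t ∈ P ((j : ℕ) + 1), f t +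
          ∑ t ∈ univ.filter (fun i : Fin N => ¬ ((i : ℕ) < (j : ℕ) + 1)), f t := by
        intro f
        rw [hP]
        exact (Finset.sum_filter_add_sum_filter_not _ _ _).symm
      have htail : ∑ t ∈ univ.filter (fun i : Fin N => ¬ ((i : ℕ) < (j : ℕ) + 1)), z t =
          ∑ t ∈ univ.filter (fun i : Fin N => ¬ ((i : ℕ) < (j : ℕ) + 1)), d t := by
        refine Finset.sum_congr rfl fun i hi => hge i ?_
        simp only [Finset.mem_filter, Finset.mem_univ, true_and, not_lt] at hi
        exact Fin.lt_def.2 (by omega)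
      have h1 := hsplit z
      have h2 := hsplit d
      have h3 := hpreP j
      rw [hPsucc] at h1 h2
      linarith
    set k := (univ.filter fun i : Fin N => j < i ∧ z i < d i).min' hE2 with hk
    have hk_mem : j < k ∧ z k < d k := (Finset.mem_filter.1 (Finset.min'_mem _ hE2)).2
    have hk_min : ∀ i : Fin N, j < i → i < k → z i = d i := by
      intro i hji hik
      have h1 := hj_max i hji
      have h2 : ¬ (z i < d i) := by
        intro h'
        have := Finset.min'_le (univ.filter fun i : Fin N => j < i ∧ z i < d i) i
          (Finset.mem_filter.2 ⟨Finset.mem_univ i, hji, h'⟩)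
        rw [← hk] at this
        exact absurd hik (not_lt.2 this)
      exact le_antisymm h1 (not_lt.1 h2)
    have hjk : j ≠ k := ne_of_lt hk_mem.1
    -- the transfer amount
    set δ : ℝ := min (z j - d j) (d k - z k) with hδ
    have hδpos : 0 < δ := lt_min (by linarith) (by linarith [hk_mem.2])
    have hδ1 : δ ≤ z j - d j := min_le_left _ _
    have hδ2 : δ ≤ d k - z k := min_le_right _ _
    have hgap : δ < z j - z k := by
      have : d k ≤ d j := hd hk_mem.1.le
      linarith [hk_mem.2]
    -- the new vector
    set z' : Fin N → ℝ := fun i => if i = j then z j - δ else if i = k then z k + δ else z i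
      with hz'
    have hz'j : z' j = z j - δ := by simp [hz']
    have hz'k : z' k = z k + δ := by simp [hz', Ne.symm hjk]
    have hz'o : ∀ i, i ≠ j → i ≠ k → z' i = z i := fun i h1 h2 => by simp [hz', h1, h2]
    -- `z'` is a `T`-transform of `z`, hence in `K`
    have hz'K : z' ∈ K := by
      set lam : ℝ := 1 - δ / (z j - z k) with hlam
      have hzjk : 0 < z j - z k := by linarith
      have hlam0 : 0 ≤ lam := by
        rw [hlam, sub_nonneg, div_le_one hzjk]
        exact hgap.le
      have hlam1 : lam ≤ 1 := by
        rw [hlam, sub_le_self_iff]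
        exact div_nonneg hδpos.le hzjk.le
      have hconv := hK hzK (hswap z hzK j k) hlam0 (sub_nonneg.2 hlam1) (by ring)
      have heq : lam • z + (1 - lam) • (z ∘ Equiv.swap j k) = z' := by
        funext i
        simp only [Pi.add_apply, Pi.smul_apply, Function.comp_apply, smul_eq_mul]
        by_cases hij : i = j
        · subst hij
          rw [Equiv.swap_apply_left, hz'j, hlam]
          field_simp
          ring
        · by_cases hik : i = k
          · subst hik
            rw [Equiv.swap_apply_right, hz'k, hlam]
            field_simp
            ring
          · rw [Equiv.swap_apply_of_ne_of_ne hij hik, hz'o i hij hik]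
            ring
      rw [← heq]
      exact hconv
    -- sums
    have split3 : ∀ f : Fin N → ℝ, ∑ i, f i = f j + f k + ∑ i ∈ (univ.erase j).erase k, f i := by
      intro f
      rw [← Finset.add_sum_erase _ _ (Finset.mem_univ j), ← Finset.add_sum_erase _ _
        (Finset.mem_erase.2 ⟨Ne.symm hjk, Finset.mem_univ k⟩), add_assoc]
    have hrest : ∀ i ∈ (univ.erase j).erase k, z' i = z i := by
      intro i hi
      simp only [Finset.mem_erase] at hi
      exact hz'o i hi.2.1 hi.1
    have hsum' : ∑ i, z' i = ∑ i, d i := by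
      rw [← hsum, split3 z', split3 z, Finset.sum_congr rfl hrest, hz'j, hz'k]
      ring
    -- prefix sums of `z'`
    have hpre' : ∀ ℓ : ℕ, ∑ i ∈ P ℓ, d i ≤ ∑ i ∈ P ℓ, z' i := by
      intro ℓ
      rcases le_or_gt ℓ j with hℓj | hℓj
      · -- `ℓ ≤ j`: the prefix avoids `j` and `k`
        have : ∑ i ∈ P ℓ, z' i = ∑ i ∈ P ℓ, z i := by
          refine Finset.sum_congr rfl fun i hi => hz'o i ?_ ?_
          · rintro rfl
            simp [hP] at hi
            omega
          · rintro rfl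
            simp [hP] at hi
            have := hk_mem.1
            rw [Fin.lt_def] at this
            omega
        rw [this]
        exact hpreP ℓ
      rcases le_or_gt ℓ k with hℓk | hℓk
      · -- `j < ℓ ≤ k`: the prefix contains `j` but not `k`; it loses `δ`
        have hjP : j ∈ P ℓ := by simp [hP]; exact hℓj
        have hkP : k ∉ P ℓ := by simp [hP]; exact hℓk
        have h1 : ∑ i ∈ P ℓ, z' i = ∑ i ∈ P ℓ, z i - δ := by
          rw [← Finset.add_sum_erase _ _ hjP, ← Finset.add_sum_erase _ _ hjP, hz'j]
          have : ∑ i ∈ (P ℓ).erase j, z' i = ∑ i ∈ (P ℓ).erase j, z i := by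
            refine Finset.sum_congr rfl fun i hi => hz'o i (Finset.mem_erase.1 hi).1 ?_
            rintro rfl
            exact hkP (Finset.mem_erase.1 hi).2
          rw [this]
          ring
        -- `∑_{P ℓ} z - ∑_{P ℓ} d = (∑_{P j} z - ∑_{P j} d) + (z j - d j) + 0 ≥ δ`
        have h2 : ∑ i ∈ P ℓ, z i - ∑ i ∈ P ℓ, d i =
            (∑ i ∈ P ((j : ℕ) + 1), z i - ∑ i ∈ P ((j : ℕ) + 1), d i) := by
          have hsub : P ((j : ℕ) + 1) ⊆ P ℓ := by
            intro i hi
            simp only [hP, Finset.mem_filter, Finset.mem_univ, true_and] at hi ⊢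
            omega
          rw [← Finset.sum_sdiff hsub, ← Finset.sum_sdiff hsub (f := d)]
          have : ∑ i ∈ P ℓ \ P ((j : ℕ) + 1), z i = ∑ i ∈ P ℓ \ P ((j : ℕ) + 1), d i := by
            refine Finset.sum_congr rfl fun i hi => ?_
            simp only [hP, Finset.mem_sdiff, Finset.mem_filter, Finset.mem_univ, true_and,
              not_lt] at hi
            refine hk_min i (Fin.lt_def.2 (by omega)) (Fin.lt_def.2 ?_)
            have := Fin.lt_def.1 hk_mem.1
            omega
          rw [this]
          ring
        have h3 := hpreP j
        rw [h1]
        rw [hPsucc, hPsucc] at h2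
        linarith
      · -- `k < ℓ`: the prefix contains both; unchanged sum
        have hjP : j ∈ P ℓ := by
          simp [hP]
          have := Fin.lt_def.1 hk_mem.1
          omega
        have hkP : k ∈ (P ℓ).erase j := by
          simp [hP, Ne.symm hjk]
          exact hℓk
        have : ∑ i ∈ P ℓ, z' i = ∑ i ∈ P ℓ, z i := by
          rw [← Finset.add_sum_erase _ _ hjP, ← Finset.add_sum_erase _ _ hjP,
            ← Finset.add_sum_erase _ _ hkP, ← Finset.add_sum_erase _ _ hkP, hz'j, hz'k]
          have : ∑ i ∈ ((P ℓ).erase j).erase k, z' i = ∑ i ∈ ((P ℓ).erase j).erase k, z i := by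
            refine Finset.sum_congr rfl fun i hi => ?_
            simp only [Finset.mem_erase] at hi
            exact hz'o i hi.2.1 hi.1
          rw [this]
          ring
        rw [this]
        exact hpreP ℓ
    -- `z'` is antitone
    have hz'anti : Antitone z' := by
      have hvj1 : z' j ≤ z j := by rw [hz'j]; linarith
      have hvj2 : d j ≤ z' j := by rw [hz'j]; linarith
      have hvk1 : z k ≤ z' k := by rw [hz'k]; linarith
      have hvk2 : z' k ≤ d k := by rw [hz'k]; linarith
      have hdjk : d k ≤ d j := hd hk_mem.1.le
      have hjk' : j < k := hk_mem.1
      intro a b hab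
      rcases hab.lt_or_eq with hab | hab
      swap
      · rw [hab]
      by_cases hbj : b = j
      · rw [hbj] at hab ⊢
        have haj : a ≠ j := ne_of_lt hab
        have hak : a ≠ k := fun h => by
          rw [h] at hab
          exact absurd (hjk'.trans hab) (lt_irrefl _)
        rw [hz'o a haj hak]
        exact hvj1.trans (hz hab.le)
      by_cases hbk : b = k
      · rw [hbk] at hab ⊢
        by_cases haj : a = j
        · rw [haj]
          exact hvk2.trans (hdjk.trans hvj2)
        · have hak : a ≠ k := ne_of_lt hab
          rw [hz'o a haj hak]
          rcases lt_or_gt_of_ne haj with haj' | haj'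
          · exact hvk2.trans (hdjk.trans (hj_mem.le.trans (hz haj'.le)))
          · rw [hk_min a haj' hab]
            exact hvk2.trans (hd hab.le)
      · rw [hz'o b hbj hbk]
        by_cases haj : a = j
        · rw [haj] at hab ⊢
          rcases lt_or_gt_of_ne hbk with hbk' | hbk'
          · rw [hk_min b hab hbk']
            exact (hd hab.le).trans hvj2
          · exact (hz hbk'.le).trans (hvk1.trans (hvk2.trans (hdjk.trans hvj2)))
        · by_cases hak : a = k
          · rw [hak] at hab ⊢
            exact (hz hab.le).trans hvk1
          · rw [hz'o a haj hak]
            exact hz hab.le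
    -- the number of disagreements drops
    have hcard : (univ.filter fun i => z' i ≠ d i).card ≤ m := by
      have hsub : (univ.filter fun i => z' i ≠ d i) ⊆ (univ.filter fun i => z i ≠ d i) := by
        intro i hi
        simp only [Finset.mem_filter, Finset.mem_univ, true_and] at hi ⊢
        by_cases hij : i = j
        · subst hij; exact ne_of_gt hj_mem
        · by_cases hik : i = k
          · subst hik; exact ne_of_lt hk_mem.2
          · rwa [hz'o i hij hik] at hi
      -- and one of `j`, `k` is a new agreement
      have hstrict : (univ.filter fun i => z' i ≠ d i) ⊂ (univ.filter fun i => z i ≠ d i) := by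
        refine Finset.ssubset_iff_subset_ne.2 ⟨hsub, fun heq => ?_⟩
        rcases min_choice (z j - d j) (d k - z k) with h | h
        · have : j ∈ (univ.filter fun i => z i ≠ d i) := by simp [ne_of_gt hj_mem]
          rw [← heq] at this
          simp only [Finset.mem_filter, Finset.mem_univ, true_and, hz'j] at this
          apply this
          rw [← hδ] at h
          linarith
        · have : k ∈ (univ.filter fun i => z i ≠ d i) := by simp [ne_of_lt hk_mem.2]
          rw [← heq] at this
          simp only [Finset.mem_filter, Finset.mem_univ, true_and, hz'k] at this
          apply this
          rw [← hδ] at h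
          linarith
      have := Finset.card_lt_card hstrict
      omega
    exact ih z' hcard hz'anti hz'K hsum' hpre'

/-- **Rado's theorem, membership form.** If `K ⊆ ℝ^N` is convex and permutation invariant,
`z ∈ K`, and `d` satisfies `∑ d = ∑ z` and `∑_{i<ℓ} d↓ ≤ ∑_{i<ℓ} z` for all `ℓ` after sorting
`d` decreasingly along `τ` (so `d ≺ z`), then `d ∈ K`. [folklore] -/
theorem mem_of_majorized {K : Set (Fin N → ℝ)} (hK : Convex ℝ K)
    (hperm : ∀ z ∈ K, ∀ σ : Equiv.Perm (Fin N), z ∘ σ ∈ K) {z d : Fin N → ℝ} (hz : z ∈ K)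
    (τ : Equiv.Perm (Fin N)) (hτ : Antitone (d ∘ τ)) (hsum : ∑ i, d i = ∑ i, z i)
    (hpre : ∀ ℓ : ℕ, ∑ i ∈ univ.filter (fun i : Fin N => (i : ℕ) < ℓ), d (τ i) ≤
      ∑ i ∈ univ.filter (fun i : Fin N => (i : ℕ) < ℓ), z i) : d ∈ K := by
  obtain ⟨π, hπ⟩ := exists_perm_antitone z
  have hzπ : z ∘ π ∈ K := hperm z hz π
  have h := mem_of_majorized_of_antitone hK (fun w hw j k => hperm w hw _) hτ (z ∘ π) hπ hzπ
    (by
      rw [show ∑ i, (z ∘ π) i = ∑ i, z i from Equiv.sum_comp π z,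
        show ∑ i, (d ∘ τ) i = ∑ i, d i from Equiv.sum_comp τ d, hsum])
    (fun ℓ => (hpre ℓ).trans (sum_prefix_le_sum_prefix_comp_of_antitone z π hπ ℓ))
  have : d = (d ∘ τ) ∘ τ.symm := by
    funext i
    simp
  rw [this]
  exact hperm _ h τ.symm

end HLP

/-! ### Elementary semidefinite lifts with no exponential cones -/

section Units

variable {E : Type*} [AddCommGroup E] [Module ℝ E]

/-- **LMI unit.** `{x | L x ⪰ 0}` for a linear `L : E → Sym_m` has a lift of psd-size `m`.
[cite: BentalElghaouiNemirovski2009, App. A.2.4.2 rule (iii)] -/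
theorem hasExpPsdLift_posSemidef {m : ℕ} (L : E →ₗ[ℝ] Matrix (Fin m) (Fin m) ℝ) :
    HasExpPsdLift {x | (L x).PosSemidef} 0 m := by
  have h := (hasExpPsdLift_expPsdCone 0 m).comap_linearMap
    ((LinearMap.inr ℝ (Fin 0 → ℝ × ℝ × ℝ) (Matrix (Fin m) (Fin m) ℝ)).comp L)
  have hset : ((LinearMap.inr ℝ (Fin 0 → ℝ × ℝ × ℝ) (Matrix (Fin m) (Fin m) ℝ)).comp L) ⁻¹'
      expPsdCone 0 m = {x | (L x).PosSemidef} := by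
    ext x
    simp [mem_expPsdCone_iff]
  rwa [hset] at h

/-- **Half-spaces as `1 × 1` LMIs.** `{x | f x ≤ c}` has a lift of psd-size `1` and no
exponential cone. [folklore] -/
theorem hasExpPsdLift_halfSpace_psd (f : E →ₗ[ℝ] ℝ) (c : ℝ) : HasExpPsdLift {x | f x ≤ c} 0 1 := by
  rw [hasExpPsdLift_iff]
  refine ⟨0, (LinearMap.inr ℝ (Fin 0 → ℝ × ℝ × ℝ) (Matrix (Fin 1) (Fin 1) ℝ)).comp
    (((-f).comp (LinearMap.fst ℝ E (Fin 0 → ℝ))).smulRight (1 : Matrix (Fin 1) (Fin 1) ℝ)),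
    ((0 : Fin 0 → ℝ × ℝ × ℝ), c • (1 : Matrix (Fin 1) (Fin 1) ℝ)), fun x => ?_⟩
  simp only [LinearMap.comp_apply, LinearMap.smulRight_apply, LinearMap.neg_apply,
    LinearMap.fst_apply, LinearMap.inr_apply, Prod.mk_add_mk, add_zero, IsEmpty.forall_iff,
    true_and, exists_const, smul_one_eq_diagonal, diagonal_add, posSemidef_diagonal_iff,
    Set.mem_setOf_eq]
  constructor
  · intro h _
    linarith
  · intro h
    have := h 0
    linarith

/-- **Hyperplanes** `{x | f x = c}`: psd-size `2` (two `1 × 1` blocks). [folklore] -/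
theorem hasExpPsdLift_hyperplane_psd (f : E →ₗ[ℝ] ℝ) (c : ℝ) : HasExpPsdLift {x | f x = c} 0 2 := by
  have h := (hasExpPsdLift_halfSpace_psd f c).inter (hasExpPsdLift_halfSpace_psd (-f) (-c))
  have hset : {x | f x ≤ c} ∩ {x | (-f) x ≤ -c} = {x | f x = c} := by
    ext x
    simp only [Set.mem_inter_iff, Set.mem_setOf_eq, LinearMap.neg_apply, neg_le_neg_iff]
    exact ⟨fun h => le_antisymm h.1 h.2, fun h => ⟨h.le, h.ge⟩⟩
  rwa [hset] at h

/-- **Finite intersections** indexed by `Fin L` with a uniform size bound. [folklore] -/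
theorem hasExpPsdLift_forall_fin {L c : ℕ} {C : Fin L → Set E} (h : ∀ ℓ, HasExpPsdLift (C ℓ) 0 c) :
    HasExpPsdLift {x | ∀ ℓ, x ∈ C ℓ} 0 (L * c) := by
  induction L with
  | zero =>
    have : {x : E | ∀ ℓ : Fin 0, x ∈ C ℓ} = Set.univ := by
      ext x
      simp
    rw [this, Nat.zero_mul]
    exact hasExpPsdLift_univ
  | succ L ih =>
    have h1 := (h 0).inter (ih (C := fun ℓ => C ℓ.succ) fun ℓ => h ℓ.succ)
    have hset : C 0 ∩ {x | ∀ ℓ : Fin L, x ∈ C ℓ.succ} = {x | ∀ ℓ, x ∈ C ℓ} := by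
      ext x
      simp only [Set.mem_inter_iff, Set.mem_setOf_eq, Fin.forall_fin_succ]
    rw [hset] at h1
    convert h1 using 1
    ring

end Units

/-! ### Orthogonal diagonalisation: bookkeeping -/

section Diagonalisation

variable {n : Type*} [Fintype n] [DecidableEq n]

/-- Real spectral theorem in `U diag(d) Uᵀ` form. [folklore] -/
theorem exists_orthogonal_conj_diagonal {Y : Matrix n n ℝ} (hY : Y.IsHermitian) :
    ∃ U : Matrix n n ℝ, U * Uᵀ = 1 ∧ Y = U * diagonal hY.eigenvalues * Uᵀ := by
  refine ⟨hY.eigenvectorUnitary, ?_, ?_⟩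
  · have h := Matrix.mem_unitaryGroup_iff.1 hY.eigenvectorUnitary.2
    rwa [star_eq_conjTranspose, conjTranspose_eq_transpose_of_trivial] at h
  · have h := hY.spectral_theorem
    rw [Unitary.conjStarAlgAut_apply, star_eq_conjTranspose, conjTranspose_eq_transpose_of_trivial]
      at h
    have hd : (RCLike.ofReal ∘ hY.eigenvalues : n → ℝ) = hY.eigenvalues := by
      funext i
      simp
    rw [hd] at h
    exact h

/-- A positive semidefinite real matrix is `U diag(d) Uᵀ` with `U` orthogonal and `d ≥ 0`.
[folklore] -/
theorem exists_orthogonal_conj_diagonal_of_posSemidef {Z : Matrix n n ℝ} (hZ : Z.PosSemidef) :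
    ∃ (U : Matrix n n ℝ) (d : n → ℝ), U * Uᵀ = 1 ∧ (∀ i, 0 ≤ d i) ∧ Z = U * diagonal d * Uᵀ := by
  obtain ⟨U, hU, h⟩ := exists_orthogonal_conj_diagonal hZ.1
  exact ⟨U, _, hU, hZ.eigenvalues_nonneg, h⟩

/-- Entries of `U diag(z) Uᵀ`. [folklore] -/
theorem conj_diagonal_apply (U : Matrix n n ℝ) (z : n → ℝ) (i l : n) :
    (U * diagonal z * Uᵀ) i l = ∑ k, U i k * z k * U l k := by
  rw [Matrix.mul_apply]
  refine Finset.sum_congr rfl fun k _ => ?_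
  rw [mul_diagonal, transpose_apply]

/-- Re-indexing a diagonalisation along a permutation `σ` of the eigenvalues. [folklore] -/
theorem conj_diagonal_eq_submatrix (U : Matrix n n ℝ) (z : n → ℝ) (σ : Equiv.Perm n) :
    U * diagonal z * Uᵀ = U.submatrix id σ * diagonal (z ∘ σ) * (U.submatrix id σ)ᵀ := by
  ext i l
  rw [conj_diagonal_apply, conj_diagonal_apply]
  simp only [submatrix_apply, id, Function.comp_apply]
  exact (Equiv.sum_comp σ (fun k => U i k * z k * U l k)).symm

omit [DecidableEq n] in
/-- The re-indexed eigenvector matrix is still orthogonal. [folklore] -/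
theorem submatrix_mul_transpose_submatrix (U : Matrix n n ℝ) (σ : Equiv.Perm n) :
    U.submatrix id σ * (U.submatrix id σ)ᵀ = U * Uᵀ := by
  ext i l
  simp only [mul_apply, transpose_apply, submatrix_apply, id]
  exact Equiv.sum_comp σ (fun k => U i k * U l k)

/-- `tr (U diag(a) Uᵀ) = ∑ aᵢ` for `Uᵀ U = I`. [folklore] -/
theorem trace_conj_diagonal {U : Matrix n n ℝ} (hU : U * Uᵀ = 1) (a : n → ℝ) :
    trace (U * diagonal a * Uᵀ) = ∑ i, a i := by
  rw [trace_mul_cycle, mul_eq_one_comm.1 hU, Matrix.one_mul, trace_diagonal]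

/-- `U diag(a) Uᵀ ⪰ 0` for `a ≥ 0`. [folklore] -/
theorem posSemidef_conj_diagonal (U : Matrix n n ℝ) {a : n → ℝ} (ha : ∀ i, 0 ≤ a i) :
    (U * diagonal a * Uᵀ).PosSemidef := by
  have h := (posSemidef_diagonal_iff.2 ha).mul_mul_conjTranspose_same U
  rwa [conjTranspose_eq_transpose_of_trivial] at h

/-- `s • 1 = U (s • 1) Uᵀ` and hence `U diag(a) Uᵀ + s I - U diag(z) Uᵀ = U diag(a + s - z) Uᵀ`.
[folklore] -/
theorem conj_diagonal_add_smul_one_sub {U : Matrix n n ℝ} (hU : U * Uᵀ = 1) (a z : n → ℝ)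
    (s : ℝ) : U * diagonal a * Uᵀ + s • (1 : Matrix n n ℝ) - U * diagonal z * Uᵀ =
      U * diagonal (fun i => a i + s - z i) * Uᵀ := by
  have h1 : s • (1 : Matrix n n ℝ) = U * diagonal (fun _ => s) * Uᵀ := by
    rw [← smul_one_eq_diagonal, Matrix.mul_smul, Matrix.mul_one, Matrix.smul_mul, hU]
  rw [h1, ← Matrix.add_mul, ← Matrix.mul_add, diagonal_add, ← Matrix.sub_mul, ← Matrix.mul_sub,
    diagonal_sub]

/-- **Ky Fan, easy half (diagonal form).** If `Z + s I - U diag(d) Uᵀ ⪰ 0` with `Uᵀ U = I` then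
`dᵢ ≤ (Uᵀ Z U)ᵢᵢ + s` for every `i` (test against the `i`-th column of `U`).
[cite: SaundersonParrilo2014, Lemma 8] -/
theorem le_diag_add_of_lmi {U : Matrix n n ℝ} (hU : U * Uᵀ = 1) {d : n → ℝ} {Z : Matrix n n ℝ}
    {s : ℝ} (h : (Z + s • (1 : Matrix n n ℝ) - U * diagonal d * Uᵀ).PosSemidef) (i : n) :
    d i ≤ (Uᵀ * Z * U) i i + s := by
  have hU' : Uᵀ * U = 1 := mul_eq_one_comm.1 hU
  have hW := h.conjTranspose_mul_mul_same U
  rw [conjTranspose_eq_transpose_of_trivial] at hW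
  have hcalc : Uᵀ * (Z + s • (1 : Matrix n n ℝ) - U * diagonal d * Uᵀ) * U =
      Uᵀ * Z * U + s • (1 : Matrix n n ℝ) - diagonal d := by
    rw [Matrix.mul_sub, Matrix.sub_mul, Matrix.mul_add, Matrix.add_mul, Matrix.mul_smul,
      Matrix.mul_one, Matrix.smul_mul, hU']
    congr 1
    calc Uᵀ * (U * diagonal d * Uᵀ) * U = (Uᵀ * U) * diagonal d * (Uᵀ * U) := by
          simp only [Matrix.mul_assoc]
      _ = diagonal d := by rw [hU', Matrix.one_mul, Matrix.mul_one]
  rw [hcalc] at hW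
  have := hW.diag_nonneg (i := i)
  simp only [Matrix.sub_apply, Matrix.add_apply, Matrix.smul_apply, Matrix.one_apply_eq, smul_eq_mul,
    mul_one, diagonal_apply_eq] at this
  linarith

/-- **Ky Fan, easy half (sum form).** If moreover `Z ⪰ 0` then for every set `T` of indices
`∑_{i ∈ T} dᵢ ≤ tr Z + |T| s`. [cite: SaundersonParrilo2014, Lemma 8] -/
theorem sum_le_trace_add_of_lmi {U : Matrix n n ℝ} (hU : U * Uᵀ = 1) {d : n → ℝ}
    {Z : Matrix n n ℝ} {s : ℝ} (hZ : Z.PosSemidef)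
    (h : (Z + s • (1 : Matrix n n ℝ) - U * diagonal d * Uᵀ).PosSemidef) (T : Finset n) :
    ∑ i ∈ T, d i ≤ trace Z + T.card * s := by
  have hZ' := hZ.conjTranspose_mul_mul_same U
  rw [conjTranspose_eq_transpose_of_trivial] at hZ'
  have h1 : ∑ i ∈ T, d i ≤ ∑ i ∈ T, ((Uᵀ * Z * U) i i + s) :=
    Finset.sum_le_sum fun i _ => le_diag_add_of_lmi hU h i
  have h2 : ∑ i ∈ T, (Uᵀ * Z * U) i i ≤ ∑ i, (Uᵀ * Z * U) i i :=
    Finset.sum_le_sum_of_subset_of_nonneg (Finset.subset_univ T) fun i _ _ => hZ'.diag_nonneg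
  have h3 : trace (Uᵀ * Z * U) = trace Z := by
    rw [trace_mul_cycle, hU, Matrix.one_mul]
  have h3' : ∑ i, (Uᵀ * Z * U) i i = trace Z := by
    rw [← h3]
    rfl
  rw [Finset.sum_add_distrib, Finset.sum_const, nsmul_eq_mul] at h1
  linarith

end Diagonalisation

/-! ### The lift of a spectral set -/

section SpectralSet

variable {m r : ℕ} {K : Set (Fin m → ℝ)}

local notation "Eₘ" => Matrix (Fin m) (Fin m) ℝ
local notation "Fₘ" => Fin m → ℝ

/-- **Semidefinite lift of spectral sets (Saunderson–Parrilo Prop. 1 with Lemmas 6–8).**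
If `K ⊆ ℝ^m` is permutation invariant and has a lifted LMI representation of psd-size `r`, then
the spectral set `{U diag(z) Uᵀ : U Uᵀ = I, z ∈ K}` (the symmetric matrices whose spectrum lies in
`K`) has one of psd-size `r + 2 + m(2m+1)`: it is the shadow of
`{(Y, z) | z ∈ K, tr Y = ∑ zᵢ, ∀ ℓ < m ∃ s, Z ⪰ 0 : Z + sI - Y ⪰ 0, tr Z + ℓ s ≤ ∑_{i<ℓ} zᵢ}`
(printed: "`C = {X : ∃ z s.t. (X,z) ∈ SH_n, diag(z) ∈ C}`" with the semidefinite description of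
the Schur–Horn cone). [cite: SaundersonParrilo2014, Prop. 1] -/
theorem hasExpPsdLift_spectralSet (hK : HasExpPsdLift K 0 r)
    (hperm : ∀ z ∈ K, ∀ σ : Equiv.Perm (Fin m), z ∘ σ ∈ K) :
    HasExpPsdLift {Y : Matrix (Fin m) (Fin m) ℝ | ∃ U : Matrix (Fin m) (Fin m) ℝ, U * Uᵀ = 1 ∧
      ∃ z ∈ K, Y = U * diagonal z * Uᵀ} 0 (r + 2 + m * (2 * m + 1)) := by
  classical
  -- linear data
  let Ylin : (Eₘ × Fₘ) × (ℝ × Eₘ) →ₗ[ℝ] Eₘ := (LinearMap.fst ℝ Eₘ Fₘ).comp (LinearMap.fst ℝ _ _)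
  let zlin : (Eₘ × Fₘ) × (ℝ × Eₘ) →ₗ[ℝ] Fₘ := (LinearMap.snd ℝ Eₘ Fₘ).comp (LinearMap.fst ℝ _ _)
  let slin : (Eₘ × Fₘ) × (ℝ × Eₘ) →ₗ[ℝ] ℝ := (LinearMap.fst ℝ ℝ Eₘ).comp (LinearMap.snd ℝ _ _)
  let Zlin : (Eₘ × Fₘ) × (ℝ × Eₘ) →ₗ[ℝ] Eₘ := (LinearMap.snd ℝ ℝ Eₘ).comp (LinearMap.snd ℝ _ _)
  let pref : Fin m → (Fₘ →ₗ[ℝ] ℝ) := fun ℓ =>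
    ∑ i ∈ univ.filter (fun i : Fin m => (i : ℕ) < (ℓ : ℕ)), LinearMap.proj i
  have pref_apply : ∀ (ℓ : Fin m) (z : Fₘ),
      pref ℓ z = ∑ i ∈ univ.filter (fun i : Fin m => (i : ℕ) < (ℓ : ℕ)), z i := by
    intro ℓ z
    simp only [pref, LinearMap.coe_sum, Finset.sum_apply, LinearMap.proj_apply]
  let tot : Fₘ →ₗ[ℝ] ℝ := ∑ i, LinearMap.proj i
  have tot_apply : ∀ z : Fₘ, tot z = ∑ i, z i := by
    intro z
    simp only [tot, LinearMap.coe_sum, Finset.sum_apply, LinearMap.proj_apply]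
  -- the pieces
  set S₁ : Set (Eₘ × Fₘ) := (LinearMap.snd ℝ Eₘ Fₘ) ⁻¹' K with hS₁
  set T : Eₘ × Fₘ →ₗ[ℝ] ℝ := (Matrix.traceLinearMap (Fin m) ℝ ℝ).comp (LinearMap.fst ℝ Eₘ Fₘ) -
    tot.comp (LinearMap.snd ℝ Eₘ Fₘ) with hT
  set S₂ : Set (Eₘ × Fₘ) := {p | T p = 0} with hS₂
  set C : Fin m → Set ((Eₘ × Fₘ) × (ℝ × Eₘ)) := fun ℓ =>
    {w | (Zlin w).PosSemidef} ∩ {w | ((Zlin + slin.smulRight (1 : Eₘ) - Ylin) w).PosSemidef} ∩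
      {w | ((Matrix.traceLinearMap (Fin m) ℝ ℝ).comp Zlin + ((ℓ : ℕ) : ℝ) • slin -
        (pref ℓ).comp zlin) w ≤ 0} with hC
  set S₃ : Set (Eₘ × Fₘ) := {p | ∀ ℓ : Fin m, p ∈ Prod.fst '' C ℓ} with hS₃
  -- sizes
  have h₁ : HasExpPsdLift S₁ 0 r := hK.comap_linearMap _
  have h₂ : HasExpPsdLift S₂ 0 2 := hasExpPsdLift_hyperplane_psd T 0
  have hCℓ : ∀ ℓ : Fin m, HasExpPsdLift (C ℓ) 0 (2 * m + 1) := by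
    intro ℓ
    have := ((hasExpPsdLift_posSemidef Zlin).inter
      (hasExpPsdLift_posSemidef (Zlin + slin.smulRight (1 : Eₘ) - Ylin))).inter
      (hasExpPsdLift_halfSpace_psd ((Matrix.traceLinearMap (Fin m) ℝ ℝ).comp Zlin +
        ((ℓ : ℕ) : ℝ) • slin - (pref ℓ).comp zlin) 0)
    convert this using 1
    ring
  have h₃ : HasExpPsdLift S₃ 0 (m * (2 * m + 1)) :=
    hasExpPsdLift_forall_fin fun ℓ => (hCℓ ℓ).fst_image
  have hS : HasExpPsdLift (S₁ ∩ S₂ ∩ S₃) 0 (r + 2 + m * (2 * m + 1)) := (h₁.inter h₂).inter h₃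
  -- unfold the memberships
  have memC : ∀ (ℓ : Fin m) (Y : Eₘ) (z : Fₘ) (s : ℝ) (Z : Eₘ), ((Y, z), (s, Z)) ∈ C ℓ ↔
      Z.PosSemidef ∧ (Z + s • (1 : Eₘ) - Y).PosSemidef ∧
        trace Z + ((ℓ : ℕ) : ℝ) * s ≤ ∑ i ∈ univ.filter (fun i : Fin m => (i : ℕ) < (ℓ : ℕ)), z i := by
    intro ℓ Y z s Z
    simp only [hC, Set.mem_inter_iff, Set.mem_setOf_eq, LinearMap.sub_apply, LinearMap.add_apply,
      LinearMap.comp_apply, LinearMap.smulRight_apply, LinearMap.smul_apply, Matrix.traceLinearMap_apply,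
      pref_apply, smul_eq_mul, sub_nonpos, and_assoc, Ylin, zlin, slin, Zlin, LinearMap.fst_apply,
      LinearMap.snd_apply]
  have memS₃ : ∀ (Y : Eₘ) (z : Fₘ), (Y, z) ∈ S₃ ↔ ∀ ℓ : Fin m, ∃ (s : ℝ) (Z : Eₘ),
      Z.PosSemidef ∧ (Z + s • (1 : Eₘ) - Y).PosSemidef ∧
        trace Z + ((ℓ : ℕ) : ℝ) * s ≤ ∑ i ∈ univ.filter (fun i : Fin m => (i : ℕ) < (ℓ : ℕ)), z i := by
    intro Y z
    rw [hS₃, Set.mem_setOf_eq]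
    refine forall_congr' fun ℓ => ⟨?_, ?_⟩
    · rintro ⟨⟨p, s, Z⟩, hmem, hp⟩
      simp only at hp
      subst hp
      exact ⟨s, Z, (memC ℓ Y z s Z).1 hmem⟩
    · rintro ⟨s, Z, h⟩
      exact ⟨((Y, z), (s, Z)), (memC ℓ Y z s Z).2 h, rfl⟩
  have memS₂ : ∀ (Y : Eₘ) (z : Fₘ), (Y, z) ∈ S₂ ↔ trace Y = ∑ i, z i := by
    intro Y z
    simp only [hS₂, hT, Set.mem_setOf_eq, LinearMap.sub_apply, LinearMap.comp_apply,
      LinearMap.fst_apply, LinearMap.snd_apply, Matrix.traceLinearMap_apply, tot_apply, sub_eq_zero]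
  -- the set identity
  have hset : Prod.fst '' (S₁ ∩ S₂ ∩ S₃) = {Y : Eₘ | ∃ U : Matrix (Fin m) (Fin m) ℝ, U * Uᵀ = 1 ∧
      ∃ z ∈ K, Y = U * diagonal z * Uᵀ} := by
    ext Y
    simp only [Set.mem_image, Set.mem_inter_iff, Prod.exists, exists_and_right, exists_eq_right,
      Set.mem_setOf_eq]
    constructor
    · rintro ⟨z, ⟨hz, h2⟩, h3⟩
      rw [hS₁, Set.mem_preimage, LinearMap.snd_apply] at hz
      rw [memS₂] at h2
      rw [memS₃] at h3
      -- `Y` is symmetric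
      have hYsymm : Y.IsHermitian := by
        rcases Nat.eq_zero_or_pos m with hm | hm
        · subst hm
          ext i j
          exact Fin.elim0 i
        · obtain ⟨s, Z, hZ, hW, -⟩ := h3 ⟨0, hm⟩
          have h1 : (s • (1 : Eₘ)).IsHermitian := by
            rw [smul_one_eq_diagonal]
            exact isHermitian_diagonal _
          have hH := (hZ.1.add h1).sub hW.1
          rwa [sub_sub_cancel] at hH
      -- diagonalise and sort decreasingly
      obtain ⟨U₀, hU₀, hYU₀⟩ := exists_orthogonal_conj_diagonal hYsymm
      set d₀ := hYsymm.eigenvalues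
      obtain ⟨τ, hτ⟩ := exists_perm_antitone d₀
      set d : Fₘ := d₀ ∘ τ with hd_def
      set U := U₀.submatrix id τ with hU_def
      have hU : U * Uᵀ = 1 := by rw [hU_def, submatrix_mul_transpose_submatrix, hU₀]
      have hYU : Y = U * diagonal d * Uᵀ := by
        rw [hYU₀, hU_def, hd_def, conj_diagonal_eq_submatrix U₀ d₀ τ]
      -- prefix domination `∑_{i<ℓ} d ≤ ∑_{i<ℓ} z`
      have hpre : ∀ ℓ : ℕ, ∑ i ∈ univ.filter (fun i : Fin m => (i : ℕ) < ℓ), d i ≤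
          ∑ i ∈ univ.filter (fun i : Fin m => (i : ℕ) < ℓ), z i := by
        intro ℓ
        rcases lt_or_ge ℓ m with hℓ | hℓ
        · obtain ⟨s, Z, hZ, hW, hle⟩ := h3 ⟨ℓ, hℓ⟩
          rw [hYU] at hW
          have := sum_le_trace_add_of_lmi hU hZ hW (univ.filter (fun i : Fin m => (i : ℕ) < ℓ))
          rw [card_filter_val_lt hℓ.le] at this
          exact this.trans hle
        · rw [filter_val_lt_of_le hℓ, ← h2, hYU, trace_conj_diagonal hU]
      have hsum : ∑ i, d i = ∑ i, z i := by rw [← h2, hYU, trace_conj_diagonal hU]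
      have hdK : d ∈ K := mem_of_majorized hK.convex hperm hz (Equiv.refl _)
        (by simpa using hτ) hsum (by simpa using hpre)
      exact ⟨U, hU, d, hdK, hYU⟩
    · rintro ⟨U₀, hU₀, z₀, hz₀, hY⟩
      obtain ⟨π, hπ⟩ := exists_perm_antitone z₀
      set z : Fₘ := z₀ ∘ π with hz_def
      set U := U₀.submatrix id π with hU_def
      have hU : U * Uᵀ = 1 := by rw [hU_def, submatrix_mul_transpose_submatrix, hU₀]
      have hYU : Y = U * diagonal z * Uᵀ := by
        rw [hY, hU_def, hz_def, conj_diagonal_eq_submatrix U₀ z₀ π]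
      have hzK : z ∈ K := hperm z₀ hz₀ π
      refine ⟨z, ⟨?_, ?_⟩, ?_⟩
      · rw [hS₁, Set.mem_preimage, LinearMap.snd_apply]
        exact hzK
      · rw [memS₂, hYU, trace_conj_diagonal hU]
      · rw [memS₃]
        intro ℓ
        refine ⟨z ℓ, U * diagonal (fun i => max (z i - z ℓ) 0) * Uᵀ,
          posSemidef_conj_diagonal U fun i => le_max_right _ _, ?_, ?_⟩
        · rw [hYU, conj_diagonal_add_smul_one_sub hU]
          refine posSemidef_conj_diagonal U fun i => ?_
          have := le_max_left (z i - z ℓ) 0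
          linarith
        · rw [trace_conj_diagonal hU]
          -- `∑ max (zᵢ - z_ℓ) 0 = ∑_{i<ℓ} zᵢ - ℓ z_ℓ`
          rw [← Finset.sum_filter_add_sum_filter_not univ (fun i : Fin m => (i : ℕ) < (ℓ : ℕ))]
          have hA : ∑ i ∈ univ.filter (fun i : Fin m => (i : ℕ) < (ℓ : ℕ)), max (z i - z ℓ) 0 =
              ∑ i ∈ univ.filter (fun i : Fin m => (i : ℕ) < (ℓ : ℕ)), z i - ((ℓ : ℕ) : ℝ) * z ℓ := by
            rw [← card_filter_val_lt (N := m) (ℓ := ℓ) ℓ.2.le]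
            rw [card_filter_val_lt (N := m) (ℓ := ℓ) ℓ.2.le]
            have : ∀ i ∈ univ.filter (fun i : Fin m => (i : ℕ) < (ℓ : ℕ)), max (z i - z ℓ) 0 =
                z i - z ℓ := by
              intro i hi
              rw [Finset.mem_filter] at hi
              exact max_eq_left (sub_nonneg.2 (hπ (Fin.le_def.2 hi.2.le)))
            rw [Finset.sum_congr rfl this, Finset.sum_sub_distrib, Finset.sum_const,
              card_filter_val_lt ℓ.2.le, nsmul_eq_mul]
          have hB : ∑ i ∈ univ.filter (fun i : Fin m => ¬ ((i : ℕ) < (ℓ : ℕ))), max (z i - z ℓ) 0 =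
              0 := by
            refine Finset.sum_eq_zero fun i hi => ?_
            rw [Finset.mem_filter, not_lt] at hi
            exact max_eq_right (sub_nonpos.2 (hπ (Fin.le_def.2 hi.2)))
          rw [hA, hB]
          linarith
  rw [← hset]
  exact hS.fst_image

end SpectralSet


end Literature.Analysis.Convex

end
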